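import Literature.MathematicalPhysics.QuantumFieldTheory.Balaban1983to89.T3PrintedRegularMinimiser
import Literature.MathematicalPhysics.QuantumFieldTheory.Balaban1983to89.B15Prop1HolonomyObstruction
import HarnessLib

/-!
# `UnitScaleTiltRegPrNotWindowOrbit` — PRINT'S GAUGE-INVARIANT REGULAR CLASS `RegPr` (BOTH CLAUSES, EVERY RADIUS) DOES NOT MEET THE `SU(2)`-GAUGE ORBIT
# OF THE NE9 MODEL WINDOW `‖U(b) − 1‖ ≤ ᾱη` ON THE SMALL MEMBER TORI — ★★OWNER ym3-torus-plan g30 WORD 14 as a kernel certificate at the member carrier (WORD 15 GO)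

Cell `ym3-torus` (HUMAN RULING D-0037, YM ladder rung R3 = continuum `SU(2)` Yang–Mills on T³ — NOT d = 4, NOT infinite volume, NOT a mass gap, NOT Clay), width
seat `ym3-torus-px16` g7; count-neutral helper of the crux `stmt-QuantumFields-19200`; certificate ∕ negative-knowledge class — discharges NO displayed row.

THE POINT.  The EX display of record S32ᴸ (`…Prop7StubEXOfChartPiecesTwS32L`, 89 binders) carries twelve CURVED print rows (`h349 hCk h137kπ h137kΔ h133 h88 hPos₁ hPosπ
hPosΔ norm_G norm_H₁ norm_Hπ`) quantified as `∀ (i : Idx L) (U₀), RegPr i.1.1 i.1.2.1 i.1.2.2 (α L) U₀ → …` over print's regular class [Balaban1985Variational] (2) =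
[Balaban1985RegularSpaces] (1.7) + (1.9) (`T3PrintedRegularMinimiser.RegPr`: small plaquette variables AND small covariant divergence of the plaquette field), whereas
every closed letter of the tree's NE9 tower (`B9Eq342GreenPrimeTower*Closed`, `B9Eq326WoodburyLettersTower`, `B9Eq325RofUkSupRowClosed`, …) lives on the MODEL WINDOW
«`‖U(b) − 1‖ ≤ α·η` on every fine bond» (pub-balaban «WALLED ON A MODEL», O-NE9-1).  WORD 14 (2026-08-29) records in prose that `RegPr` does not imply the window «not
even up to gauge … for the low members» (px16 g6 LOCATE «CURVED-WINDOW» (V3), px7 g6 LOCATE V-2 (C)).  THIS FILE IS THAT SENTENCE AS A THEOREM on the display's own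
carrier `GaugeField (F.P K) 0 SU(2)`, class `RegPr` and letters `GaugeField.gaugeAct`, `‖· − 1‖_op`: for every member `(F, n, K)` and window constant `ᾱ` with
`ᾱ·(2·L^{F.m+K})·η < 2`, `η = L^{−(K−n)}` (equivalently `ᾱ·L^{F.m+n} < 1` when `n ≤ K`), there is `U₀` with `RegPr F n K ρ U₀` FOR EVERY `ρ > 0` which NO `SU(2)` gauge
transformation brings bondwise within `ᾱη` of `1` (`regPr_not_windowOrbit`).  Witness = the POLYAKOV-SLICE FIELD ([Balaban1985Averaging] (44)–(45) p. 24; the tree's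
`B7Eq45TorusGaugeOrbit` §4 on the B9 carrier): `U₀(b) = −1` on the `μ₀`-bonds issuing from the last `μ₀`-slice, `1` elsewhere — EVERY plaquette variable EQUALS `1` (a
flat connection, Wilson action `0`, in `PlaqSmall δ` for every `δ > 0`), the plaquette field is identically `1` so its covariant divergence VANISHES (`DivSmall` at every
radius), while the closed `μ₀`-line holonomy is `−1` at distance `2` from `1`; the tree's holonomy obstruction on THIS carrier (`B15Prop1HolonomyObstruction`: a gauge
bondwise `ε`-near `1` along a closed walk of `N` steps forces the gauge-invariant holonomy within `N·ε` of `1`) excludes every gauge once `N·ε < 2`, `N = 2L^{F.m+K}`.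
No chart to the B9 carrier is needed: the obstruction is imported, only the slice field's bookkeeping is typed here.

WHAT THIS FILE PROVES (theorems only — no `def`, no `instance`, no `sorry`; axioms standard):
* §1 (any group ∕ `GaugeGroup`, any `c`) `slice_src_shift_of_ne`, `slice_of_ne`, ★`slice_plaqComm_eq_one`, `holT_slice_plaqWord_eq_one`, `plaqHol_slice_eq_one`,
  `plaqSmall_slice`, `wilsonAction_slice`;  §2 (any normed algebra) `plaqFT_slice_eq_one`, ★`covDivT_slice_eq_zero`;
* §3 (any `GaugeGroup`, any `c`) `netDisp_replicate`, `walkEnd_line`, `holAt_walk_replicate_eq_one`, ★`holAt_line_slice` (`= c`),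
  ★★`not_exists_gauge_smallBond_slice` (`N·ε < dist1 c` ⇒ no gauge is bondwise `ε`-near `1`);
* §4 (member carrier, `SU(2)`) `dist1_negOne_eq_two`, `unitsField_toUField_slice`, ★`regPr_slice` (every `SU(2)` slice field is in `RegPr F n K ρ`, all `ρ > 0`),
  ★★★`regPr_not_smallBondOrbit` (`(2L^{F.m+K})·ε < 2`), ★★★`regPr_not_windowOrbit` (`ᾱ·(2L^{F.m+K})·η < 2`, norm letters), `regPr_not_windowOrbit_of_lt_one` (`n ≤ K`,
  `ᾱ·L^{F.m+n} < 1`).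

HONEST SCOPE.  Claims NO row false (the curved rows are print's theorems [Balaban1985BackgroundPropagators] Thm 3.3∕3.11∕3.12 read at the member, presumably true; print's
road = cube-wise localisation with local axial gauges + the random-walk expansion (3.51)ff, NOT in the tree); certifies only that files built on the tower's closed ends
reach the curved rows at most on the gauge orbit of the model window, which misses `RegPr`-configurations in every member of physical size `L^{F.m+n} < 1∕ᾱ` (every depth
`K ≥ n`).  Changes no display ∕ registry text.  `stub_existenceMinimalOrbit`, cruxes 19200 ∕ 20520 ∕ 19936 OPEN; YM₃ on T³ = rung R3; the YM mass gap is NOT proved.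

References: T. Bałaban [Balaban1985Averaging] CMP 98 (1985) 17–51 ((8)–(9) p.18, (19)–(20) p.21, (44)–(45) p.24); [Balaban1985RegularSpaces] CMP 99 (1985) 75–102
((1.1)–(1.2) p.76, (1.7)–(1.9) p.77); [Balaban1985Variational] CMP 102 (1985) 277–309 ((2) p.278); [Balaban1985BackgroundPropagators] CMP 99 (1985) 389–434 ((3.35) p.396,
(3.51) p.398); [Balaban1987RG1] CMP 109 (1987) 249–301 ((1.10)–(1.12) p.262).
-/
noncomputable section
open scoped Matrix.Norms.L2Operator

namespace Summit.QuantumFields.YangMills.Theorems.RegPrNotWindowOrbit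
open Literature.MathematicalPhysics.QuantumFieldTheory.Balaban1983to89
open Literature.MathematicalPhysics.QuantumFieldTheory.Balaban1983to89.T4Continuum (netDisp netDisp_cons LStep walk walkEnd holAt holAt_nil holAt_cons
  walkEnd_eq_self_of_netDisp)
open Literature.MathematicalPhysics.QuantumFieldTheory.Balaban1983to89.B7Prop1Explicit (plaqWord)
open Literature.MathematicalPhysics.QuantumFieldTheory.Balaban1983to89.T4WordSystemGaugeBound (length_walk')
open Literature.MathematicalPhysics.QuantumFieldTheory.Balaban1983to89.B15Prop1HolonomyObstruction (not_exists_gauge_nearFlat_along_of_lt)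
open Literature.MathematicalPhysics.QuantumFieldTheory.Balaban1983to89.T3ContinuumYM3Torus (T3Family)
open Literature.MathematicalPhysics.QuantumFieldTheory.Balaban1983to89.T3RegularMinimiser (regThreshold regThreshold_pos)
open Literature.MathematicalPhysics.QuantumFieldTheory.Balaban1983to89.T3PrintedRegularMinimiser (RegPr DivSmall)
open Literature.MathematicalPhysics.QuantumFieldTheory.Balaban1983to89.B10Eq27TorusAxialLog (holT holT_plaqWord toUField unitsField suIncl)
open Literature.MathematicalPhysics.QuantumFieldTheory.Balaban1983to89.B10Eq68TorusRegularity (plaqFT covDerivT covDivT)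
open Literature.MathematicalPhysics.QuantumFieldTheory.Balaban1983to89.B7Eq78Linearization (conjR conjR_one)

/-! ## §1 The Polyakov-slice field: its plaquette-type commutators are `1` (any group) -/
section Slice
variable {P : Params} {j : ℕ} {G : Type*} [Group G] (c : G) (μ₀ : Fin P.d)
/-- The slice field `U₀(⟨x, κ⟩) = c` if `κ = μ₀` and `x_{μ₀} = N − 1`, `= 1` otherwise, takes the same value at `⟨x, κ⟩` and `⟨x + e_λ, κ⟩` for `λ ≠ μ₀`
(the shift does not move the `μ₀`-coordinate). [cite: Balaban1985Averaging, (44)–(45) p.24] -/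
theorem slice_src_shift_of_ne (x : Site P j) (κ : Fin P.d) {lam : Fin P.d} (hlam : lam ≠ μ₀) :
    (fun b : PBond P j => if b.dir = μ₀ ∧ (b.src μ₀).val + 1 = P.sitesPerDir j then c else 1) ⟨x.shift lam, κ⟩ =
      (fun b : PBond P j => if b.dir = μ₀ ∧ (b.src μ₀).val + 1 = P.sitesPerDir j then c else 1) ⟨x, κ⟩ := by
  have hx : (x.shift lam) μ₀ = x μ₀ := by rw [Site.shift_apply, if_neg (Ne.symm hlam)]
  simp only [hx]
/-- The slice field is `1` on every bond of direction `κ ≠ μ₀`. [cite: Balaban1985Averaging, (44)–(45) p.24] -/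
theorem slice_of_ne (x : Site P j) {κ : Fin P.d} (hκ : κ ≠ μ₀) :
    (fun b : PBond P j => if b.dir = μ₀ ∧ (b.src μ₀).val + 1 = P.sitesPerDir j then c else 1) ⟨x, κ⟩ = 1 := by
  simp only [hκ, false_and, if_false]
/-- ★ **EVERY PLAQUETTE-TYPE COMMUTATOR OF THE SLICE FIELD IS `1`**: for `κ ≠ λ`, `U₀(x,κ)·U₀(x+e_κ,λ)·U₀(x+e_λ,κ)⁻¹·U₀(x,λ)⁻¹ = 1` — at most one of `κ, λ`
is `μ₀`, the two bonds of the other direction carry `1`, and the two `μ₀`-bonds have the same `μ₀`-coordinate, hence the same value. [cite: Balaban1985Averaging, (9) p.18, (44)–(45) p.24] -/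
theorem slice_plaqComm_eq_one (x : Site P j) {κ lam : Fin P.d} (hκl : κ ≠ lam) :
    (fun b : PBond P j => if b.dir = μ₀ ∧ (b.src μ₀).val + 1 = P.sitesPerDir j then c else 1) ⟨x, κ⟩ *
      (fun b : PBond P j => if b.dir = μ₀ ∧ (b.src μ₀).val + 1 = P.sitesPerDir j then c else 1) ⟨x.shift κ, lam⟩ *
      ((fun b : PBond P j => if b.dir = μ₀ ∧ (b.src μ₀).val + 1 = P.sitesPerDir j then c else 1) ⟨x.shift lam, κ⟩)⁻¹ *
      ((fun b : PBond P j => if b.dir = μ₀ ∧ (b.src μ₀).val + 1 = P.sitesPerDir j then c else 1) ⟨x, lam⟩)⁻¹ = 1 := by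
  by_cases hκ : κ = μ₀
  · subst hκ
    rw [slice_of_ne c κ (x.shift κ) (Ne.symm hκl), slice_of_ne c κ x (Ne.symm hκl), slice_src_shift_of_ne c κ x κ (Ne.symm hκl),
      mul_one, inv_one, mul_one, mul_inv_cancel]
  · rw [slice_of_ne c μ₀ x hκ, slice_of_ne c μ₀ (x.shift lam) hκ, slice_src_shift_of_ne c μ₀ x lam hκ, one_mul, inv_one, mul_one,
      mul_inv_cancel]
/-- **THE SLICE FIELD TRANSPORTS EVERY PLAQUETTE WORD TO `1`** (`κ ≠ λ`, either orientation). [cite: Balaban1985Averaging, (9) p.18, (44)–(45) p.24] -/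
theorem holT_slice_plaqWord_eq_one (x : Site P j) {κ lam : Fin P.d} (hκl : κ ≠ lam) :
    holT (fun b : PBond P j => if b.dir = μ₀ ∧ (b.src μ₀).val + 1 = P.sitesPerDir j then c else 1) x (plaqWord κ lam) = 1 := by
  rw [holT_plaqWord]
  exact slice_plaqComm_eq_one c μ₀ x hκl
end Slice
section SlicePlaq
variable {P : Params} {j : ℕ} {G : Type*} [GaugeGroup G] (c : G) (μ₀ : Fin P.d)
/-- **EVERY PLAQUETTE VARIABLE OF THE SLICE FIELD EQUALS `1`** (`Setup`'s `GaugeField.plaqHol`): the slice field is a FLAT lattice connection.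
[cite: Balaban1985Averaging, (9) p.18, (44)–(45) p.24] -/
theorem plaqHol_slice_eq_one (p : Plaq P j) :
    GaugeField.plaqHol (fun b : PBond P j => if b.dir = μ₀ ∧ (b.src μ₀).val + 1 = P.sitesPerDir j then c else 1) p = 1 :=
  slice_plaqComm_eq_one c μ₀ p.src (ne_of_lt p.hμν)
/-- Hence the slice field satisfies the plaquette clause `PlaqSmall δ` for EVERY `δ > 0` (`dist1 1 = 0`). [cite: Balaban1987RG1, (0.18) p.255; Balaban1985Averaging, (45) p.24] -/
theorem plaqSmall_slice {δ : ℝ} (hδ : 0 < δ) :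
    PlaqSmall δ (fun b : PBond P j => if b.dir = μ₀ ∧ (b.src μ₀).val + 1 = P.sitesPerDir j then c else 1) := by
  intro p
  rw [plaqHol_slice_eq_one, GaugeGroup.dist1_one]
  exact hδ
/-- The Wilson action of the slice field vanishes: it is an absolute minimiser (flat connection) in a non-trivial holonomy sector. [cite: Balaban1987RG1, (0.2) p.252; Balaban1985Averaging, (45) p.24] -/
theorem wilsonAction_slice (w : ℝ) :
    wilsonAction w (fun b : PBond P j => if b.dir = μ₀ ∧ (b.src μ₀).val + 1 = P.sitesPerDir j then c else 1) = 0 := by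
  unfold wilsonAction
  refine Finset.sum_eq_zero fun p _ => ?_
  rw [plaqHol_slice_eq_one, GaugeGroup.reTr_one, sub_self, mul_zero]
end SlicePlaq

/-! ## §2 The plaquette FIELD of a units-valued slice field is `1`; its covariant divergence vanishes (any normed algebra) -/
section SliceDiv
variable {P : Params} {s : ℕ} {𝔸 : Type*} [NormedRing 𝔸] [NormedAlgebra ℂ 𝔸] (c : 𝔸ˣ) (μ₀ : Fin P.d)
omit [NormedAlgebra ℂ 𝔸] in
/-- The plaquette field `F_{κλ} = ∂U₀` ([Balaban1985RegularSpaces] (1.2)) of the slice field is identically `1` for `κ ≠ λ`. [cite: Balaban1985RegularSpaces, (1.2) p.76; Balaban1985Averaging, (45) p.24] -/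
theorem plaqFT_slice_eq_one {κ lam : Fin P.d} (hκl : κ ≠ lam) (x : Site P s) :
    plaqFT (fun b : PBond P s => if b.dir = μ₀ ∧ (b.src μ₀).val + 1 = P.sitesPerDir s then c else 1) κ lam x = 1 := by
  unfold plaqFT
  rw [holT_slice_plaqWord_eq_one c μ₀ x hκl, Units.val_one]
/-- ★ **THE COVARIANT DIVERGENCE OF THE SLICE FIELD'S PLAQUETTE FIELD VANISHES AT EVERY BOND** ([Balaban1985RegularSpaces] (1.1)–(1.2): each term is
`η⁻¹(R(U₀(·)⁻¹)1 − 1) = 0`). [cite: Balaban1985RegularSpaces, (1.1)–(1.2) p.76, (1.9) p.77] -/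
theorem covDivT_slice_eq_zero (η : ℝ) (μ : Fin P.d) (x : Site P s) :
    covDivT η (fun b : PBond P s => if b.dir = μ₀ ∧ (b.src μ₀).val + 1 = P.sitesPerDir s then c else 1) μ x = 0 := by
  have hterm : ∀ {κ lam : Fin P.d}, κ ≠ lam → ∀ ν : Fin P.d,
      covDerivT η (fun b : PBond P s => if b.dir = μ₀ ∧ (b.src μ₀).val + 1 = P.sitesPerDir s then c else 1) ν
        (plaqFT (fun b : PBond P s => if b.dir = μ₀ ∧ (b.src μ₀).val + 1 = P.sitesPerDir s then c else 1) κ lam) x = 0 := by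
    intro κ lam hκl ν
    unfold covDerivT
    rw [plaqFT_slice_eq_one c μ₀ hκl, plaqFT_slice_eq_one c μ₀ hκl, conjR_one, sub_self, smul_zero]
  unfold covDivT
  rw [Finset.sum_eq_zero fun ν hν => hterm (ne_of_lt (Finset.mem_Iio.mp hν)) ν,
    Finset.sum_eq_zero fun ν hν => hterm (ne_of_lt (Finset.mem_Ioi.mp hν)) ν, sub_self]
end SliceDiv

/-! ## §3 The straight closed `μ₀`-line: its holonomy of the slice field is `c`; the holonomy obstruction (any `GaugeGroup`) -/
section Line
variable {P : Params} {j : ℕ}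
/-- Net displacement of the straight word `(+e_{μ₀})^k`: `k` in direction `μ₀`, `0` elsewhere. [folklore] -/
theorem netDisp_replicate (μ₀ ν : Fin P.d) : ∀ k : ℕ, netDisp (List.replicate k ((μ₀, true) : Fin P.d × Bool)) ν = if μ₀ = ν then (k : ℤ) else 0
  | 0 => by simp [netDisp]
  | k + 1 => by
    rw [List.replicate_succ, netDisp_cons, netDisp_replicate μ₀ ν k]
    by_cases hμ : μ₀ = ν
    · simp only [hμ, if_true]; push_cast; ring
    · simp only [hμ, if_false, add_zero]
/-- **THE STRAIGHT `μ₀`-LINE OF `N = #sites per direction` STEPS IS CLOSED** from every base point. [folklore] -/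
theorem walkEnd_line (x : Site P j) (μ₀ : Fin P.d) :
    walkEnd x (List.replicate (P.sitesPerDir j) ((μ₀, true) : Fin P.d × Bool)) = x := by
  refine walkEnd_eq_self_of_netDisp fun ν => ?_
  rw [netDisp_replicate]
  split_ifs
  · rw [Int.cast_natCast, ZMod.natCast_self]
  · rw [Int.cast_zero]
variable {G : Type*} [GaugeGroup G] (c : G) (μ₀ : Fin P.d)
/-- Along `k` forward `μ₀`-steps from a site whose `μ₀`-coordinate stays below the slice (`x_{μ₀} + k < N`) the slice field transports to `1`. [cite: Balaban1985Averaging, (9) p.18, (44) p.24] -/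
theorem holAt_walk_replicate_eq_one :
    ∀ (k : ℕ) (x : Site P j), (x μ₀).val + k < P.sitesPerDir j →
      holAt (fun b : PBond P j => if b.dir = μ₀ ∧ (b.src μ₀).val + 1 = P.sitesPerDir j then c else 1)
        (walk x (List.replicate k ((μ₀, true) : Fin P.d × Bool))) = 1
  | 0, x, _ => by rw [List.replicate_zero, walk, holAt_nil]
  | k + 1, x, hx => by
    have hne : ¬ ((x μ₀).val + 1 = P.sitesPerDir j) := by omega
    have h1 : ((1 : ZMod (P.sitesPerDir j))).val = 1 := by
      rw [ZMod.val_one_eq_one_mod, Nat.one_mod_eq_one.mpr (by omega)]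
    have hval : ((x.shift μ₀) μ₀).val = (x μ₀).val + 1 := by
      rw [Site.shift_apply, if_pos rfl, ZMod.val_add_of_lt (by rw [h1]; omega), h1]
    have ih := holAt_walk_replicate_eq_one k (x.shift μ₀) (by rw [hval]; omega)
    rw [List.replicate_succ, walk, holAt_cons, ih, mul_one]
    simp only [if_true, true_and, hne, if_false]
/-- ★ **THE CLOSED `μ₀`-LINE HOLONOMY OF THE SLICE FIELD IS `c`**: based at the slice site `x₀ = (N−1, …, N−1)` the first step crosses the slice bond (value `c`),
the remaining `N − 1` steps carry `1`. [cite: Balaban1985Averaging, (9) p.18, (44)–(45) p.24] -/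
theorem holAt_line_slice :
    holAt (fun b : PBond P j => if b.dir = μ₀ ∧ (b.src μ₀).val + 1 = P.sitesPerDir j then c else 1)
      (walk (fun _ => ((P.sitesPerDir j - 1 : ℕ) : ZMod (P.sitesPerDir j)) : Site P j)
        (List.replicate (P.sitesPerDir j) ((μ₀, true) : Fin P.d × Bool))) = c := by
  have hN : 0 < P.sitesPerDir j := Nat.pos_of_ne_zero (P.sitesPerDir_ne_zero j)
  set x₀ : Site P j := fun _ => ((P.sitesPerDir j - 1 : ℕ) : ZMod (P.sitesPerDir j)) with hx₀
  have hx₀val : (x₀ μ₀).val = P.sitesPerDir j - 1 := by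
    rw [hx₀]; simp only; rw [ZMod.val_natCast, Nat.mod_eq_of_lt (by omega)]
  have hcond : (x₀ μ₀).val + 1 = P.sitesPerDir j := by rw [hx₀val]; omega
  have hshift : ((x₀.shift μ₀) μ₀).val = 0 := by
    rw [Site.shift_apply, if_pos rfl]
    have : x₀ μ₀ + 1 = ((P.sitesPerDir j : ℕ) : ZMod (P.sitesPerDir j)) := by
      rw [hx₀]; simp only; rw [← Nat.cast_add_one, Nat.sub_add_cancel (by omega : 1 ≤ P.sitesPerDir j)]
    rw [this, ZMod.natCast_self, ZMod.val_zero]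
  have hrep : List.replicate (P.sitesPerDir j) ((μ₀, true) : Fin P.d × Bool) =
      (μ₀, true) :: List.replicate (P.sitesPerDir j - 1) (μ₀, true) := by
    conv_lhs => rw [show P.sitesPerDir j = P.sitesPerDir j - 1 + 1 by omega, List.replicate_succ]
  rw [hrep, walk, holAt_cons, holAt_walk_replicate_eq_one c μ₀ (P.sitesPerDir j - 1) (x₀.shift μ₀) (by rw [hshift]; omega), mul_one]
  simp only [if_true, true_and, hcond]
/-- ★★ **NO GAUGE BRINGS THE SLICE FIELD BONDWISE WITHIN `ε` OF `1` ONCE `N·ε < dist1 c`** (`N` = sites per direction): the closed `μ₀`-line has `N` steps and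
holonomy `c`, and a gauge bondwise `ε`-near `1` along it would force `dist1 c ≤ N·ε` (`B15Prop1HolonomyObstruction.not_exists_gauge_nearFlat_along_of_lt`).
[cite: Balaban1985Averaging, (8) p.18, (19)–(20) p.21, (45) p.24; Balaban1987RG1, (1.10)–(1.12) p.262] -/
theorem not_exists_gauge_smallBond_slice {ε : ℝ} (hlt : (P.sitesPerDir j : ℝ) * ε < dist1 c) :
    ¬ ∃ σ : GaugeTransf P j G, ∀ b : PBond P j,
      dist1 (GaugeField.gaugeAct σ (fun b : PBond P j => if b.dir = μ₀ ∧ (b.src μ₀).val + 1 = P.sitesPerDir j then c else 1) b) ≤ ε := by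
  rintro ⟨σ, hσ⟩
  rcases lt_or_ge ε 0 with hε | hε
  · obtain ⟨b⟩ : Nonempty (PBond P j) := ⟨⟨default, μ₀⟩⟩
    exact absurd ((GaugeGroup.dist1_nonneg _).trans (hσ b)) (not_le.mpr hε)
  · set x₀ : Site P j := fun _ => ((P.sitesPerDir j - 1 : ℕ) : ZMod (P.sitesPerDir j)) with hx₀
    have hlt' : ((walk x₀ (List.replicate (P.sitesPerDir j) ((μ₀, true) : Fin P.d × Bool))).length : ℝ) * ε <
        dist1 (holAt (fun b : PBond P j => if b.dir = μ₀ ∧ (b.src μ₀).val + 1 = P.sitesPerDir j then c else 1)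
          (walk x₀ (List.replicate (P.sitesPerDir j) ((μ₀, true) : Fin P.d × Bool)))) := by
      rw [length_walk', List.length_replicate, holAt_line_slice]; exact hlt
    exact not_exists_gauge_nearFlat_along_of_lt _ x₀ _ (walkEnd_line x₀ μ₀) hε hlt' ⟨σ, fun s _ => hσ s.bond⟩
end Line

/-! ## §4 The member carrier: `SU(2)`, the class `RegPr` of the EX display, the window letters -/
section Member
open Literature.MathematicalPhysics.QuantumLattice (fundamentalRep fundamentalRep_apply)
/-- **`dist1 (−1) = 2` IN `SU(2)`** (the tree's instance: `dist1 W = ‖W − 1‖_op` through the fundamental representation; `‖−2·1‖_op = 2`). [cite: Balaban1985Averaging, (19) p.21] -/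
theorem dist1_negOne_eq_two (hmem : (-1 : Matrix (Fin 2) (Fin 2) ℂ) ∈ Matrix.specialUnitaryGroup (Fin 2) ℂ) :
    dist1 (⟨-1, hmem⟩ : Matrix.specialUnitaryGroup (Fin 2) ℂ) = 2 := by
  letI : CStarAlgebra (Matrix (Fin 2) (Fin 2) ℂ) := B10Eq29TubeLine.cstarAlgebraMatrix 2
  change ‖(-1 : Matrix (Fin 2) (Fin 2) ℂ) - 1‖ = 2
  have h2 : (-1 : Matrix (Fin 2) (Fin 2) ℂ) - 1 = (-2 : ℂ) • (1 : Matrix (Fin 2) (Fin 2) ℂ) := by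
    rw [neg_smul, two_smul]; abel
  rw [h2, norm_smul, norm_neg, CStarRing.norm_one, mul_one]
  norm_num
variable (F : T3Family) (n K : ℕ)
/-- An `SU(2)` slice field read in the units of `M₂(ℂ)` (`unitsField ∘ toUField`) is the units-valued slice field of the included element. [cite: Balaban1985Averaging, (19) p.21] -/
theorem unitsField_toUField_slice (c : Matrix.specialUnitaryGroup (Fin 2) ℂ) (μ₀ : Fin (F.P K).d) :
    unitsField (toUField (fun b : PBond (F.P K) 0 => if b.dir = μ₀ ∧ (b.src μ₀).val + 1 = (F.P K).sitesPerDir 0 then c else 1)) =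
      fun b : PBond (F.P K) 0 => if b.dir = μ₀ ∧ (b.src μ₀).val + 1 = (F.P K).sitesPerDir 0 then Unitary.toUnits (suIncl c) else 1 := by
  funext b
  show Unitary.toUnits (suIncl (if b.dir = μ₀ ∧ (b.src μ₀).val + 1 = (F.P K).sitesPerDir 0 then c else 1)) =
    (if b.dir = μ₀ ∧ (b.src μ₀).val + 1 = (F.P K).sitesPerDir 0 then Unitary.toUnits (suIncl c) else 1)
  split_ifs
  · rfl
  · rw [map_one, map_one]
/-- ★ **EVERY `SU(2)` SLICE FIELD IS IN PRINT'S REGULAR CLASS `RegPr F n K ρ` FOR EVERY RADIUS `ρ > 0`** — both clauses of [Balaban1985Variational] (2): the plaquette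
clause (every plaquette variable is `1`) and the covariant-divergence clause (1.9) (the plaquette field is `1`, its covariant divergence `0`). [cite: Balaban1985Variational, (2) p.278; Balaban1985RegularSpaces, (1.7)–(1.9) p.77] -/
theorem regPr_slice (c : Matrix.specialUnitaryGroup (Fin 2) ℂ) (μ₀ : Fin (F.P K).d) {ρ : ℝ} (hρ : 0 < ρ) :
    RegPr F n K ρ (fun b : PBond (F.P K) 0 => if b.dir = μ₀ ∧ (b.src μ₀).val + 1 = (F.P K).sitesPerDir 0 then c else 1) := by
  refine ⟨plaqSmall_slice _ μ₀ (regThreshold_pos F hρ), fun b => ?_⟩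
  rw [unitsField_toUField_slice, covDivT_slice_eq_zero, norm_zero]
  have hL : (0 : ℝ) < (F.L : ℝ)⁻¹ := inv_pos.mpr (by have := F.hL.2; exact_mod_cast (by omega : 0 < F.L))
  positivity
/-- ★★★ **`RegPr` (EVERY RADIUS) DOES NOT MEET THE `SU(2)`-ORBIT OF THE `ε`-SMALL-BOND BALL WHEN `(2L^{F.m+K})·ε < 2`**: there is `U₀ : GaugeField (F.P K) 0 SU(2)` with
`RegPr F n K ρ U₀` for all `ρ > 0` and NO gauge transformation `σ` with `dist1 ((U₀^σ)(b)) ≤ ε` at every fine bond (`dist1 W = ‖W − 1‖_op`). [cite: Balaban1985Averaging, (45) p.24; Balaban1985Variational, (2) p.278; Balaban1987RG1, (1.10)–(1.12) p.262] -/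
theorem regPr_not_smallBondOrbit {ε : ℝ} (hε : (2 * (F.L : ℝ) ^ (F.m + K)) * ε < 2) :
    ∃ U₀ : GaugeField (F.P K) 0 (Matrix.specialUnitaryGroup (Fin 2) ℂ),
      (∀ ρ : ℝ, 0 < ρ → RegPr F n K ρ U₀) ∧
      ¬ ∃ σ : GaugeTransf (F.P K) 0 (Matrix.specialUnitaryGroup (Fin 2) ℂ), ∀ b : PBond (F.P K) 0, dist1 (GaugeField.gaugeAct σ U₀ b) ≤ ε := by
  have hmem : (-1 : Matrix (Fin 2) (Fin 2) ℂ) ∈ Matrix.specialUnitaryGroup (Fin 2) ℂ := by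
    rw [Matrix.mem_specialUnitaryGroup_iff]
    refine ⟨?_, ?_⟩
    · rw [Matrix.mem_unitaryGroup_iff]; simp
    · rw [Matrix.det_neg, Matrix.det_one]; norm_num
  have μ₀ : Fin (F.P K).d := ⟨0, (F.P K).hd⟩
  refine ⟨fun b : PBond (F.P K) 0 =>
      if b.dir = μ₀ ∧ (b.src μ₀).val + 1 = (F.P K).sitesPerDir 0 then (⟨-1, hmem⟩ : Matrix.specialUnitaryGroup (Fin 2) ℂ) else 1,
    fun ρ hρ => regPr_slice F n K _ μ₀ hρ, not_exists_gauge_smallBond_slice _ μ₀ ?_⟩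
  have hN : (((F.P K).sitesPerDir 0 : ℕ) : ℝ) = 2 * (F.L : ℝ) ^ (F.m + K) := by
    show (((2 * F.L ^ (F.m + K) : ℕ)) : ℝ) = _
    push_cast; ring
  rw [dist1_negOne_eq_two, hN]; exact hε
/-- ★★★ **WORD 14 AS A THEOREM — THE WINDOW LETTERS, AS OFFERED**: for every member `(F, n, K)` and window constant `ᾱ` with `ᾱ·(2·L^{F.m+K})·η < 2`,
`η = L^{−(K−n)}`, print's class `RegPr F n K ρ` (every `ρ > 0`) contains a configuration on NO `SU(2)`-gauge orbit of the NE9 model window `‖(U(b) : M₂(ℂ)) − 1‖_op ≤ ᾱ·η`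
(`dist1` of the tree's `SU(2)` instance IS that norm; `η` written as the body `(L⁻¹)^{K−n}` of `T3SectALandauChart.eta F n K`, definitionally equal). [cite: Balaban1985Averaging, (45) p.24; Balaban1985Variational, (2) p.278; Balaban1985BackgroundPropagators, (3.35) p.396] -/
theorem regPr_not_windowOrbit {abar : ℝ} (hwin : abar * (2 * (F.L : ℝ) ^ (F.m + K)) * ((F.L : ℝ)⁻¹) ^ (K - n) < 2) :
    ∃ U₀ : GaugeField (F.P K) 0 (Matrix.specialUnitaryGroup (Fin 2) ℂ),
      (∀ ρ : ℝ, 0 < ρ → RegPr F n K ρ U₀) ∧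
      ¬ ∃ σ : GaugeTransf (F.P K) 0 (Matrix.specialUnitaryGroup (Fin 2) ℂ), ∀ b : PBond (F.P K) 0,
        ‖((GaugeField.gaugeAct σ U₀ b : Matrix.specialUnitaryGroup (Fin 2) ℂ) : Matrix (Fin 2) (Fin 2) ℂ) - 1‖ ≤ abar * ((F.L : ℝ)⁻¹) ^ (K - n) :=
  regPr_not_smallBondOrbit F n K (by linarith [hwin])
/-- The same with the window hypothesis in physical-size form: `n ≤ K` and `ᾱ·L^{F.m+n} < 1` (`(2L^{F.m+K})·ᾱ·L^{−(K−n)} = 2ᾱ·L^{F.m+n}`) — the members of small physical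
size are the obstructed ones. [cite: Balaban1985Averaging, (45) p.24; Balaban1985Variational, (2) p.278] -/
theorem regPr_not_windowOrbit_of_lt_one (hnK : n ≤ K) {abar : ℝ} (hwin : abar * (F.L : ℝ) ^ (F.m + n) < 1) :
    ∃ U₀ : GaugeField (F.P K) 0 (Matrix.specialUnitaryGroup (Fin 2) ℂ),
      (∀ ρ : ℝ, 0 < ρ → RegPr F n K ρ U₀) ∧
      ¬ ∃ σ : GaugeTransf (F.P K) 0 (Matrix.specialUnitaryGroup (Fin 2) ℂ), ∀ b : PBond (F.P K) 0,
        ‖((GaugeField.gaugeAct σ U₀ b : Matrix.specialUnitaryGroup (Fin 2) ℂ) : Matrix (Fin 2) (Fin 2) ℂ) - 1‖ ≤ abar * ((F.L : ℝ)⁻¹) ^ (K - n) := by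
  refine regPr_not_windowOrbit F n K ?_
  have hL : (0 : ℝ) < (F.L : ℝ) := by have := F.hL.2; exact_mod_cast (by omega : 0 < F.L)
  have hsplit : (F.L : ℝ) ^ (F.m + K) = (F.L : ℝ) ^ (F.m + n) * (F.L : ℝ) ^ (K - n) := by
    rw [← pow_add]; congr 1; omega
  have hcancel : (F.L : ℝ) ^ (K - n) * ((F.L : ℝ)⁻¹) ^ (K - n) = 1 := by
    rw [inv_pow, mul_inv_cancel₀ (pow_ne_zero _ hL.ne')]
  calc abar * (2 * (F.L : ℝ) ^ (F.m + K)) * ((F.L : ℝ)⁻¹) ^ (K - n)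
      = 2 * (abar * (F.L : ℝ) ^ (F.m + n)) * ((F.L : ℝ) ^ (K - n) * ((F.L : ℝ)⁻¹) ^ (K - n)) := by rw [hsplit]; ring
    _ = 2 * (abar * (F.L : ℝ) ^ (F.m + n)) := by rw [hcancel, mul_one]
    _ < 2 := by linarith
end Member

end Summit.QuantumFields.YangMills.Theorems.RegPrNotWindowOrbit

end
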